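import Summits.QuantumFields.YangMills.Theorems.BalabanUVNodesN16HolderMSDefs
import Summits.QuantumFields.BalabanUV.T4Continuum.Spine.NE3.PairLandauB8Avg
import HarnessLib

/-!
# Route «BalabanUVNodes», cluster K4 «SpineRates» — node N16 = NE3: [B8] THEOREM 2 + (1.37) AT THE PAIR WITH THE MULTI-SCALE (3.40) HÖLDER MEMBER, NAMED
# (`PairLandauGaugeB8AvgMS`) — the B8-surface hypothesis of repair R-β″'s END (`N16HolderMSEnd` ∕ `…MSEndSfClass` ∕ `…MSConst`), a CANDIDATE wording

Cell `pub-ymgap`, seat `pub-ymgap-dag-n16-c` (R134 fan-out seat, strategy s1; HUMAN RULING D-0062; chair R424 venue), generation 4, file 26 (definition lane; sequel of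
file 22 `N16HolderMSDefs`).  `--supports stmt-QuantumFields-19912` (K3‴ `SpineGivenEndpointR13`, route rev 16).  `bears_on: R4∕N16 · edge N05 → N16`.
Located item: `HOME/pub-ymgap-dag-n16-c/LOCATED-N16-HOLDER-PIN.md`, census row R-β″ (ADDENDUM 5).

WHY.  THE END of row NE3 reads [Balaban1985RegularSpaces] Theorem 2 + (1.37) at the minimiser pair in the shape `NE3.PairLandauB8Avg.PairLandauGaugeB8Avg d 𝒞 L N b g
s₁ s₂ β dom`: per pair `∃ (u, Z)`, `LandauRepB8Avg L N k W U_A u Z s₁ s₂ β` (`W := cavg L U_B = rescale L (bavg L U_B)`), whose `holder` field is the (1.36) Hölder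
member read at NEAREST-NEIGHBOUR separation.  Repair R-β″ (files 20–25) carries instead the MULTI-SCALE member of the same `Z` — print's (3.40) quotient along
every lattice line, `1 ≤ j ≤ L^k`, in THE END's letters (the line holonomy of `NE7EtaCovariantJunction` §3 as transport) — which the producer bricks
(`N16HolderMSDictionary.lipMS_AdInv_of_printLetters`, `N16HolderMSReadouts`) derive from node N05's leaf.  THIS FILE names that hypothesis, so that the END files
of R-β″ cite ONE token (`PairLandauGaugeB8AvgMS d 𝒞 L N b g s₁ s₂ β dom`) where generation 2∕3 cite `PairLandauGaugeB8Avg … β`; it implies the latter (projection).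

CONTENTS.  `PairLandauGaugeB8AvgMS` (def), `pairLandauGaugeB8AvgMS_iff` (`Iff.rfl`), `PairLandauGaugeB8AvgMS.perPair`, `pairLandauGaugeB8Avg_of_pairLandauGaugeB8AvgMS`
(projection to the shape of record at exponent β), `PairLandauGaugeB8AvgMS.mono_dom` (antitone in `dom`).
HONEST FRAMING: a definition of a hypothesis SHAPE + `Iff.rfl`-level bookkeeping; [B8] Thm 2 ∕ Prop 3 at the pair are node N05's theorems, NOT proved; N16 ∕ NE3 NOT
discharged; count-neutral; one finite T⁴ at fixed ε — NOT ℝ⁴, NOT infinite volume, NOT OS, NOT a mass gap, NOT Clay.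
-/

set_option autoImplicit false

open scoped BigOperators Matrix Matrix.Norms.L2Operator

namespace Summit.QuantumFields.YangMills.BalabanUVNodes.N16HolderMSPairDefs

open Literature.MathematicalPhysics.QuantumFieldTheory.Balaban1983to89
open B7Prop1Explicit B7Prop2Explicit
open T4AveragingDeficitWall hiding Site Plane Plaq Bond
open Summit.QuantumFields.BalabanUV.T4Continuum
open AveragingDeficitChartCalculus (cavg)
open MinimalActionSandwich (IsMinimiser)
open MinimalActionRate (Regular)
open NE3.PairLandauB8Avg (LandauRepB8Avg PairLandauGaugeB8Avg)

noncomputable section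

variable {d : ℕ} {n : Type*} [Fintype n] [DecidableEq n]

variable (d) in
/-- **[B8] THEOREM 2 + (1.37) AT THE PAIR WITH THE MULTI-SCALE HÖLDER MEMBER** (a `Prop`; asserted for no class here): for every level `k ≥ 1`, datum `V ∈ dom`
and minimiser pair `(U_A, U_B)` with `U_B` regular, `∃ (u, Z)` with `LandauRepB8Avg L N k W U_A u Z s₁ s₂ β` (`W := cavg L U_B`; the shape of record at exponent
`β`: representation, (1.38), (1.37), sup `s₁ξ`, first covariant differences `s₁ξ²`, nearest-neighbour Hölder member `s₂ξ^{2+β}`, rough Laplacian) AND the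
MULTI-SCALE member of the same `Z`: along every lattice line (`κ μ`, base `y`) and every separation `1 ≤ j ≤ L^k`, the covariant difference `j` steps ahead
transported back by the line holonomy differs from the one at the base by at most `s₂·ξ^{(2:ℝ)+β}·j^β` — [Balaban1985BackgroundPropagators] (3.40)
«sup_{x,x′:|x−x′|≦1} |x′ − x|^{−α}|R(U(Γ_{x,x′}))(D_μA_ν)(x′) − (D_μA_ν)(x)|» read along lines, i.e. [Balaban1985RegularSpaces] (1.36)₃ «β ≦ β₀ < 1» at the pair
in THE END's letters.  The hypothesis `hB8` of `N16HolderMSEnd.covRoot_holderMS_of_pairLandauGaugeB8AvgMS` is this `Prop` unfolded.  A hypothesis SHAPE (node N05's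
theorem through bricks `N16HolderMSDictionary` ∕ `N16HolderMSReadouts`; nothing proved here).
[cite: Balaban1985RegularSpaces, Thm 2 (1.36)–(1.38) p.82; Balaban1985BackgroundPropagators, (3.40) p.397] -/
@[folklore]
def PairLandauGaugeB8AvgMS (𝒞 : ℕ → Set (Site d → Fin d → (Matrix n n ℂ)ˣ)) (L N : ℕ) (b g s₁ s₂ β : ℝ)
    (dom : Set (Site d → Fin d → (Matrix n n ℂ)ˣ)) : Prop :=
  ∀ k : ℕ, 1 ≤ k → ∀ V ∈ dom, ∀ UA UB : Site d → Fin d → (Matrix n n ℂ)ˣ,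
    IsMinimiser d 𝒞 L N k V UA → IsMinimiser d 𝒞 L N (k + 1) V UB → Regular d L N b g (k + 1) UB →
      ∃ (u : Site d → (Matrix n n ℂ)ˣ) (Z : Site d → Fin d → Matrix n n ℂ), LandauRepB8Avg L N k (cavg L UB) UA u Z s₁ s₂ β ∧
        ∀ (κ μ : Fin d) (y : Site d) (j : ℕ), 1 ≤ j → j ≤ L ^ k →
          ‖Ad (((List.range j).map fun i : ℕ => cavg L UB (y + e κ + i • e μ) μ).prod)
                (Ad (cavg L UB (y + e κ + j • e μ) μ) (Z (y + (j + 1) • e μ) κ) - Z (y + j • e μ) κ)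
            - (Ad (cavg L UB (y + e κ) μ) (Z (y + e μ) κ) - Z y κ)‖ ≤ s₂ * (((L : ℝ)⁻¹) ^ k) ^ ((2 : ℝ) + β) * (j : ℝ) ^ β

/-- `PairLandauGaugeB8AvgMS` unfolded (`Iff.rfl`). [folklore] -/
theorem pairLandauGaugeB8AvgMS_iff {𝒞 : ℕ → Set (Site d → Fin d → (Matrix n n ℂ)ˣ)} {L N : ℕ} {b g s₁ s₂ β : ℝ}
    {dom : Set (Site d → Fin d → (Matrix n n ℂ)ˣ)} :
    PairLandauGaugeB8AvgMS d 𝒞 L N b g s₁ s₂ β dom ↔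
      ∀ k : ℕ, 1 ≤ k → ∀ V ∈ dom, ∀ UA UB : Site d → Fin d → (Matrix n n ℂ)ˣ,
        IsMinimiser d 𝒞 L N k V UA → IsMinimiser d 𝒞 L N (k + 1) V UB → Regular d L N b g (k + 1) UB →
          ∃ (u : Site d → (Matrix n n ℂ)ˣ) (Z : Site d → Fin d → Matrix n n ℂ), LandauRepB8Avg L N k (cavg L UB) UA u Z s₁ s₂ β ∧
            ∀ (κ μ : Fin d) (y : Site d) (j : ℕ), 1 ≤ j → j ≤ L ^ k →
              ‖Ad (((List.range j).map fun i : ℕ => cavg L UB (y + e κ + i • e μ) μ).prod)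
                    (Ad (cavg L UB (y + e κ + j • e μ) μ) (Z (y + (j + 1) • e μ) κ) - Z (y + j • e μ) κ)
                - (Ad (cavg L UB (y + e κ) μ) (Z (y + e μ) κ) - Z y κ)‖ ≤ s₂ * (((L : ℝ)⁻¹) ^ k) ^ ((2 : ℝ) + β) * (j : ℝ) ^ β :=
  Iff.rfl

/-- The per-pair body of the multi-scale B8 shape. [folklore] -/
theorem PairLandauGaugeB8AvgMS.perPair {𝒞 : ℕ → Set (Site d → Fin d → (Matrix n n ℂ)ˣ)} {L N : ℕ} {b g s₁ s₂ β : ℝ}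
    {dom : Set (Site d → Fin d → (Matrix n n ℂ)ˣ)} (h : PairLandauGaugeB8AvgMS d 𝒞 L N b g s₁ s₂ β dom)
    {k : ℕ} (hk : 1 ≤ k) {V : Site d → Fin d → (Matrix n n ℂ)ˣ} (hV : V ∈ dom) {UA UB : Site d → Fin d → (Matrix n n ℂ)ˣ}
    (hA : IsMinimiser d 𝒞 L N k V UA) (hB : IsMinimiser d 𝒞 L N (k + 1) V UB) (hreg : Regular d L N b g (k + 1) UB) :
    ∃ (u : Site d → (Matrix n n ℂ)ˣ) (Z : Site d → Fin d → Matrix n n ℂ), LandauRepB8Avg L N k (cavg L UB) UA u Z s₁ s₂ β ∧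
      ∀ (κ μ : Fin d) (y : Site d) (j : ℕ), 1 ≤ j → j ≤ L ^ k →
        ‖Ad (((List.range j).map fun i : ℕ => cavg L UB (y + e κ + i • e μ) μ).prod)
              (Ad (cavg L UB (y + e κ + j • e μ) μ) (Z (y + (j + 1) • e μ) κ) - Z (y + j • e μ) κ)
          - (Ad (cavg L UB (y + e κ) μ) (Z (y + e μ) κ) - Z y κ)‖ ≤ s₂ * (((L : ℝ)⁻¹) ^ k) ^ ((2 : ℝ) + β) * (j : ℝ) ^ β :=
  h k hk V hV UA UB hA hB hreg

/-- **THE MULTI-SCALE B8 SHAPE IMPLIES THE SHAPE OF RECORD AT EXPONENT `β`** (projection to the `LandauRepB8Avg` part): every consumer of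
`PairLandauGaugeB8Avg … s₁ s₂ β dom` (generations 2–3's producer column) is a consumer of the multi-scale shape. [folklore] -/
theorem pairLandauGaugeB8Avg_of_pairLandauGaugeB8AvgMS {𝒞 : ℕ → Set (Site d → Fin d → (Matrix n n ℂ)ˣ)} {L N : ℕ} {b g s₁ s₂ β : ℝ}
    {dom : Set (Site d → Fin d → (Matrix n n ℂ)ˣ)} (h : PairLandauGaugeB8AvgMS d 𝒞 L N b g s₁ s₂ β dom) :
    PairLandauGaugeB8Avg d 𝒞 L N b g s₁ s₂ β dom := by
  intro k hk V hV UA UB hA hB hreg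
  obtain ⟨u, Z, hZ, -⟩ := h k hk V hV UA UB hA hB hreg
  exact ⟨u, Z, hZ⟩

/-- The multi-scale B8 shape is antitone in the datum domain. [folklore] -/
theorem PairLandauGaugeB8AvgMS.mono_dom {𝒞 : ℕ → Set (Site d → Fin d → (Matrix n n ℂ)ˣ)} {L N : ℕ} {b g s₁ s₂ β : ℝ}
    {dom dom' : Set (Site d → Fin d → (Matrix n n ℂ)ˣ)} (h : PairLandauGaugeB8AvgMS d 𝒞 L N b g s₁ s₂ β dom) (hsub : dom' ⊆ dom) :
    PairLandauGaugeB8AvgMS d 𝒞 L N b g s₁ s₂ β dom' :=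
  fun k hk V hV UA UB hA hB hreg => h k hk V (hsub hV) UA UB hA hB hreg

end

end Summit.QuantumFields.YangMills.BalabanUVNodes.N16HolderMSPairDefs
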